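import Summits.AtomisticToContinuum.HydrodynamicLimit.Theses.ImplosionDichotomy
import Summits.AtomisticToContinuum.HydrodynamicLimit.Theorems.DenseExcursion.Negative.Dichotomy
import Summits.AtomisticToContinuum.HydrodynamicLimit.Theorems.DiluteSelfConsistency.Negative.Tightness

/-!
# Crux-strategist gen 3 (seat s1) — kernel companion of `STRATEGY-CENSUS.md` PART 0

Crux `DiluteSelfConsistency` (stmt-AtomisticToContinuum-3091), bet route `TwoClocks` (`hS`), also `ImplosionDichotomy`
(`hD`). This file only TYPES the new census attempts of PART 0 and proves their bookkeeping; it is not a skeleton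
(no `stub_*`, no `sorry`), registers nothing and claims nothing open.

* §L  the GUARD SPLIT (decomposition candidate L): `DSC ⇐ LevelNeverReached η₁ ∧ GuardedDSC η₁`, exact for every
      `η₁ > 0`; and the reason its second piece is dead in substance: a GUARDED dense excursion (a `DenseExcursion`
      witness truncated at first passage through a level `< η₁`) refutes `GuardedDSC η₁` by the same two lines that
      prove `DenseExcursion → ¬ DiluteSelfConsistency`.
* §S  the SEMI-UNIFORM strengthening S⁺₉ (threshold depending on the profiles only through finitely many numbers) and
      its trivial implication to the crux — recorded to show the added rigidity changes nothing at the deciding profile.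
-/

noncomputable section

namespace Summit.AtomisticToContinuum.HydrodynamicLimit.Cruxes.DiluteSelfConsistency.StrategistS1

open MeasureTheory Filter Set Topology
open Literature.MathematicalPhysics.KineticTheory Literature.Analysis.FluidPDE Literature.Analysis.FunctionSpaces
open Summit.AtomisticToContinuum.HydrodynamicLimit.Theses.ImplosionDichotomy
open Summit.AtomisticToContinuum.HydrodynamicLimit.Theorems
open Summit.AtomisticToContinuum.HydrodynamicLimit.Theorems.DenseExcursionDichotomy

/-! ## §L — decomposition candidate L: split by the Statement's own guard -/

/-- `GuardedDSC η₁`: dilute self-consistency asserted ONLY for admissible classical solutions whose packing stays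
below the guard level `η₁` on their whole interval — the shape in which the re-typed Statement (D-0032) consumes
solutions. [folklore] -/
def GuardedDSC (η₁ : ℝ) : Prop :=
  ∀ η : ℝ, 0 < η → ∀ (a₀ θ₀ : T3 → ℝ) (u₀ : T3 → V3), Continuous a₀ → Continuous θ₀ → Continuous u₀ →
    (∀ x, 0 < a₀ x) → (∀ x, 0 < θ₀ x) → ∃ σ₀ : ℝ, 0 < σ₀ ∧ ∀ σ : ℝ, 0 < σ → σ < σ₀ →
      ∀ (T : ℝ) (ρ θ : ℝ → T3 → ℝ) (u : ℝ → T3 → V3), IsHardSphereEulerSolution σ T ρ u θ →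
        (∀ t ∈ Ico 0 T, ∀ x, ρ t x * σ ^ 3 < η₁) →
        ∀ Φ : (N : ℕ) → HardSphereFlow (Torus.geometry (Fin 3)) (hsDiameter σ N) (N + 1),
          TendstoHydroFieldsAt (fun N => localGibbsLaw σ a₀ u₀ θ₀ N (Φ N)) Φ ρ u θ 0 →
            ∀ t ∈ Ico 0 T, ∀ x, ρ t x * σ ^ 3 < η

/-- `LevelNeverReached η₁`: the crux at the single level `η₁` (profile-wise threshold). [folklore] -/
def LevelNeverReached (η₁ : ℝ) : Prop :=
  ∀ (a₀ θ₀ : T3 → ℝ) (u₀ : T3 → V3), Continuous a₀ → Continuous θ₀ → Continuous u₀ →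
    (∀ x, 0 < a₀ x) → (∀ x, 0 < θ₀ x) → ∃ σ₀ : ℝ, 0 < σ₀ ∧ DiluteSelfConsistencyHoldsAt η₁ a₀ θ₀ u₀ σ₀

/-- **Assembly of split L** (`LevelNeverReached η₁ → GuardedDSC η₁ → DiluteSelfConsistency`): below the minimum of
the two thresholds every admissible solution is `η₁`-guarded by the first piece, so the second piece applies.
[folklore] -/
theorem dsc_of_guardSplit {η₁ : ℝ} (hL : LevelNeverReached η₁) (hG : GuardedDSC η₁) :
    DiluteSelfConsistency := by
  intro η hη a₀ θ₀ u₀ ha hθ hu ha0 hθ0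
  obtain ⟨σ₁, hσ₁, H₁⟩ := hL a₀ θ₀ u₀ ha hθ hu ha0 hθ0
  obtain ⟨σ₂, hσ₂, H₂⟩ := hG η hη a₀ θ₀ u₀ ha hθ hu ha0 hθ0
  refine ⟨min σ₁ σ₂, lt_min hσ₁ hσ₂, fun σ hσ hσlt T ρ θ u hE Φ h0 t ht x => ?_⟩
  have hguard : ∀ s ∈ Ico 0 T, ∀ y, ρ s y * σ ^ 3 < η₁ :=
    fun s hs y => H₁ σ hσ (lt_of_lt_of_le hσlt (min_le_left _ _)) T ρ θ u hE Φ h0 s hs y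
  exact H₂ σ hσ (lt_of_lt_of_le hσlt (min_le_right _ _)) T ρ θ u hE hguard Φ h0 t ht x

/-- **Exactness of split L**: the crux gives both pieces at every guard level `η₁ > 0`. [folklore] -/
theorem guardSplit_of_dsc (hD : DiluteSelfConsistency) {η₁ : ℝ} (hη₁ : 0 < η₁) :
    LevelNeverReached η₁ ∧ GuardedDSC η₁ :=
  ⟨fun a₀ θ₀ u₀ ha hθ hu ha0 hθ0 => hD η₁ hη₁ a₀ θ₀ u₀ ha hθ hu ha0 hθ0,
    fun η hη a₀ θ₀ u₀ ha hθ hu ha0 hθ0 => by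
      obtain ⟨σ₀, hσ₀, H⟩ := hD η hη a₀ θ₀ u₀ ha hθ hu ha0 hθ0
      exact ⟨σ₀, hσ₀, fun σ hσ hσlt T ρ θ u hE _ Φ h0 t ht x => H σ hσ hσlt T ρ θ u hE Φ h0 t ht x⟩⟩

/-- `GuardedDenseExcursion η₁`: a dense-excursion witness that is itself `η₁`-GUARDED — fixed continuous positive
profiles, a level `η > 0`, and for every `σ₀` some `σ < σ₀` with an admissible classical solution whose packing stays
`< η₁` on its whole interval and reaches `η` somewhere. (Obtained from any `DenseExcursion` witness reaching a level
`η* > 0` by TRUNCATION at the first passage through `η := min η* (η₁/2)`: the set of times at which some point has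
packing `≥ η` is closed in `[0,T)` by compactness of `𝕋³`, its infimum `t*` is positive for small `σ` because the pinned
initial packing is `O(σ³)` (`denseExcursion_false_atTimeZero`), packing `< η` on `[0,t*)`, `= η` somewhere at `t*`,
and `< η₁` on `[0, t* + δ)` by uniform continuity; restrict the solution with `IsHardSphereEulerSolution.restrict`.
This truncation is routine and is NOT formalised here.) [folklore] -/
def GuardedDenseExcursion (η₁ : ℝ) : Prop :=
  ∃ η : ℝ, 0 < η ∧ ∃ (a₀ θ₀ : T3 → ℝ) (u₀ : T3 → V3), Continuous a₀ ∧ Continuous θ₀ ∧ Continuous u₀ ∧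
    (∀ x, 0 < a₀ x) ∧ (∀ x, 0 < θ₀ x) ∧ ∀ σ₀ : ℝ, 0 < σ₀ → ∃ σ : ℝ, 0 < σ ∧ σ < σ₀ ∧
      ∃ (T : ℝ) (ρ θ : ℝ → T3 → ℝ) (u : ℝ → T3 → V3), IsHardSphereEulerSolution σ T ρ u θ ∧
        (∀ t ∈ Ico 0 T, ∀ x, ρ t x * σ ^ 3 < η₁) ∧
        (∀ Φ : (N : ℕ) → HardSphereFlow (Torus.geometry (Fin 3)) (hsDiameter σ N) (N + 1),
          TendstoHydroFieldsAt (fun N => localGibbsLaw σ a₀ u₀ θ₀ N (Φ N)) Φ ρ u θ 0) ∧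
        ∃ t ∈ Ico 0 T, ∃ x, η ≤ ρ t x * σ ^ 3

/-- **Why piece 2 of split L is dead in substance**: a guarded dense excursion at guard `η₁` refutes `GuardedDSC η₁`
(shrink the threshold under `1/2` so that Alexander's flows instantiate `∀ Φ`; same two lines as the landed
`not_denseExcursion_and_diluteSelfConsistency`). Hence, once `DenseExcursion` holds at ANY level, `GuardedDSC η₁`
fails for EVERY `η₁ > 0` by truncation — the guard buys nothing. [folklore] -/
theorem not_guardedDSC_of_guardedDenseExcursion {η₁ : ℝ} (h : GuardedDenseExcursion η₁) : ¬ GuardedDSC η₁ := by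
  intro hG
  obtain ⟨η, hη, a₀, θ₀, u₀, ha, hθ, hu, ha0, hθ0, H⟩ := h
  obtain ⟨σ₀, hσ₀, G⟩ := hG η hη a₀ θ₀ u₀ ha hθ hu ha0 hθ0
  obtain ⟨σ, hσ, hσlt, T, ρ, θ, u, hE, hguard, hA, t, ht, x, hx⟩ :=
    H (min σ₀ (1 / 2)) (lt_min hσ₀ (by norm_num))
  obtain ⟨Φ⟩ := flows_nonempty hσ (lt_of_lt_of_le hσlt (min_le_right _ _))
  exact absurd (G σ hσ (lt_of_lt_of_le hσlt (min_le_left _ _)) T ρ θ u hE hguard Φ (hA Φ) t ht x) (not_lt.2 hx)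

/-- Conversely a guarded dense excursion is in particular a dense excursion, hence refutes the crux itself
(through the landed dichotomy). [folklore] -/
theorem not_dsc_of_guardedDenseExcursion {η₁ : ℝ} (h : GuardedDenseExcursion η₁) : ¬ DiluteSelfConsistency := by
  rw [← denseExcursion_iff_not_diluteSelfConsistency]
  obtain ⟨η, hη, a₀, θ₀, u₀, ha, hθ, hu, ha0, hθ0, H⟩ := h
  refine ⟨η, hη, a₀, θ₀, u₀, ha, hθ, hu, ha0, hθ0, fun σ₀ hσ₀ => ?_⟩
  obtain ⟨σ, hσ, hσlt, T, ρ, θ, u, hE, -, hA, t, ht, x, hx⟩ := H σ₀ hσ₀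
  exact ⟨σ, hσ, hσlt, T, ρ, θ, u, hE, hA, t, ht, x, hx⟩

/-! ## §S — strengthening S⁺₉: semi-uniform threshold -/

/-- `SemiUniformDSC`: the crux with a threshold `σ₀ = F(η, B, m)` depending on the profiles only through a bound `B`
on finitely many pointwise quantities (here: the sup of `a₀, θ₀, ‖u₀‖` — any finite list of seminorms gives the same
discussion) and a positivity floor `m` — the compactness-friendly ("admits induction over a bounded profile class")
form. [folklore] -/
def SemiUniformDSC : Prop :=
  ∃ F : ℝ → ℝ → ℝ → ℝ, (∀ η B m, 0 < η → 0 < m → 0 < F η B m) ∧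
    ∀ η : ℝ, 0 < η → ∀ (B m : ℝ), 0 < m → ∀ (a₀ θ₀ : T3 → ℝ) (u₀ : T3 → V3), Continuous a₀ → Continuous θ₀ →
      Continuous u₀ → (∀ x, m ≤ a₀ x ∧ a₀ x ≤ B) → (∀ x, m ≤ θ₀ x ∧ θ₀ x ≤ B) → (∀ x, ‖u₀ x‖ ≤ B) →
        DiluteSelfConsistencyHoldsAt η a₀ θ₀ u₀ (F η B m)

/-- S⁺₉ implies the crux (every continuous profile on the compact torus has such bounds). The added rigidity buys
nothing for THIS step: the expected counterexample (one tuned smooth profile) lies in one bounded class, where S⁺₉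
and the crux assert the same thing. [folklore] -/
theorem dsc_of_semiUniform (h : SemiUniformDSC) : DiluteSelfConsistency := by
  obtain ⟨F, hF, H⟩ := h
  intro η hη a₀ θ₀ u₀ ha hθ hu ha0 hθ0
  -- bounds from compactness of 𝕋³
  obtain ⟨xa, -, hxa⟩ := isCompact_univ.exists_isMinOn univ_nonempty ha.continuousOn
  obtain ⟨xA, -, hxA⟩ := isCompact_univ.exists_isMaxOn univ_nonempty ha.continuousOn
  obtain ⟨xt, -, hxt⟩ := isCompact_univ.exists_isMinOn univ_nonempty hθ.continuousOn
  obtain ⟨xT, -, hxT⟩ := isCompact_univ.exists_isMaxOn univ_nonempty hθ.continuousOn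
  obtain ⟨xU, -, hxU⟩ := isCompact_univ.exists_isMaxOn univ_nonempty hu.norm.continuousOn
  set m : ℝ := min (a₀ xa) (θ₀ xt) with hm
  set B : ℝ := max (max (a₀ xA) (θ₀ xT)) ‖u₀ xU‖ with hB
  have hm0 : 0 < m := lt_min (ha0 xa) (hθ0 xt)
  refine ⟨F η B m, hF η B m hη hm0, H η hη B m hm0 a₀ θ₀ u₀ ha hθ hu ?_ ?_ ?_⟩
  · intro x
    exact ⟨(min_le_left _ _).trans (hxa (mem_univ x)),
      (hxA (mem_univ x)).trans ((le_max_left _ _).trans (le_max_left _ _))⟩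
  · intro x
    exact ⟨(min_le_right _ _).trans (hxt (mem_univ x)),
      (hxT (mem_univ x)).trans ((le_max_right _ _).trans (le_max_left _ _))⟩
  · intro x
    exact (hxU (mem_univ x)).trans (le_max_right _ _)

end Summit.AtomisticToContinuum.HydrodynamicLimit.Cruxes.DiluteSelfConsistency.StrategistS1

end
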